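import Summits.QuantumFields.YangMills.Theorems.BalabanUVNodesK0V23Stub3NonVacuity
import Literature.MathematicalPhysics.QuantumFieldTheory.Balaban1983to89.Node00.Record13SignFreeComparabilityOfBetaBox
import Literature.MathematicalPhysics.QuantumFieldTheory.Balaban1983to89.Node00.Record13LettersOfThm1CCMWZB

/-!
# K0⁷ V23 — THE K0 DOOR PACKAGE FOR THE N24 ENGINE v2: from the V23 stub-3ᴬ′ᴮ text ALONE (stub 1ᴮ being PROVED, 2′ being [6] Prop. 6 printed) — per family `F`, below ANY radius
# ceiling `amax > 0`, ONE ∃-package «door `(j, c, c₀, c₁; B₃, B₃′, a₀, a₁)` with riders and signs · the ᴮ (8)-sentence `h15` · the ᴮ (9)-token `h9` under `A‴` · the LOCATED-K0ε₀ letter at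
# `ε₀ = a₀` · a window `0 < γ ≤ ½` with the two letters `−(−β′)γ² ≤ 3`, `β′γ² ≤ ¾` · the sign-free box of `β₁₃` AT THE WINDOW-EDITION MEMBER `θ₁₃ᶜᶜᴹᵂᶻᴮ(j; γ; a₀; ε₀ := a₀, ε₂₉; B₃, B₃′, a₀, a₁)`
# at EVERY pair of normalisation letters `(Efl, logz)`» — the engine «N09T5»'s 30-line K0 prelude (:203–232) in ONE call, V23 ∕ ᴮ currency

Cell `pub-ymgap`, width seat `pub-ymgap-dag-n07-w3` (g17; N07 [B11] ∕ K0⁷–K1 junction).  `--kind proof --supports stmt-QuantumFields-27364 --as helper`, COUNT-NEUTRAL.  NEW leaf;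
theorems only — 0 `def`, 0 `sorry`, 0 `instance`, 0 `notation`.  ROUTE-INDEPENDENT and RESIDUE-FREE: imports g16's `…K0V23Stub3NonVacuity` ✓p770586 (⇒ `K0V23Defs`, `K0Stub1BHolds`,
`B8Prop6PrintedZdCubPGamma`, 53′ `N07Thm1Top7FromProp8GuardedB`, k0-s1-w1's `K0PrintCubeOfStepTokensGridGuardedB`), node00's `Node00/Record13SignFreeComparabilityOfBetaBox` (window
arithmetic `exists_window_letters_signFree`) and `Node00/Record13LettersOfThm1CCMWZB` (half-window ⟹ window-edition transfer, `hcompBoth` rows) — all green on both sides of the Stage-2 seam; NO `Theses` import (the crux decl is not named).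
[I] = [Balaban1987RG1]; [III] = [Balaban1988Convergent]; [15] = [Balaban1985Variational]; [6] = [Balaban1985RegularSpaces]; [P2] = [Balaban1984PropagatorsII]; [II′] = [Balaban1989LargeFieldII].

WHY (dag-n24-c g20 ENGINE-v2 DESIGN §1–§3, bus 2026-08-30 I.18504 ∕ I.18531; offer I.18765).  The K1 engine of record «N09T5» (#11022) opens with a K0 prelude: destructure stub 1-G‴, SHRINK
its radius below the door ceiling `1∕(109824·L²)`, Prop. 8's top step ⟹ [15] Thm 1's (8)-sentence (53), the (9)-supplier from 2′ (k0-s1-w3), the threshold CHOICE `ε₀ := a₀` with the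
LOCATED-K0ε₀ letter `2a₀ ≤ ε₀L²` by `2 ≤ L²`, the registered box read at that label, the window shrink with letters, the transfer to the window-edition member, NODE O's comparability rows
`hcompBoth`.  Engine v2 re-keys all of it to the V23 ∕ ᴮ names (`K0V23Defs`, `K0Stub1BHolds`, `…GridGuardedB.gauge9SupplierG3B_of_prop6MemberP`, 53′).  This file IS that prelude in the ᴮ
currency as ONE theorem per shape, so the sibling engine obtains its K0 block by `obtain ⟨…⟩ := exists_doorPackageZB_of_absBetaBoxGZBAt F (h3 F) hamax`.

CONTENTS.  §1 `exists_doorZB_below` — stub 1ᴮ (PROVED) + 2′ + 53′ ⟹ below every ceiling `amax > 0` a door with riders, signs, `h15ᴮ`, `h9ᴮ` (g16's `exists_radius_antecedentsZB_inhabited_below`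
at `a₀ := min ā amax`); §2 ★ `exists_doorPackageZB_of_absBetaBoxGZBAt` — + the V23 3ᴬ′ᴮ text ⟹ the full package at the window-edition member, letters `(Efl, logz)` ∀-quantified INSIDE (β is
letter-blind, `rfl`), with the LOCATED-K0ε₀ letter at `ε₀ = a₀`; `…_comparable` — + NODE 00's `hcompBoth` rows (`Record13LettersOfThm1CCMWZB.hcompBoth_theta13OfThm1CCMWZB_of_betaBoxSignFree`);
§3 the `∀ F` forms for the skeleton's stub type `∀ F, …GZBAt F` and for the strengthened text `…GZBEps0At`.

HONEST FRAMING (binding).  Repackaging BY NAME of LANDED theorems; NO β estimate — the box is the V23 stub-3ᴬ′ᴮ text taken as a HYPOTHESIS (NODE O's wall: [I] §1 p.264 «uniformly bounded»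
stated, proof unpublished, [II′] p.355); no value of `a₀ ∕ ε₀ ∕ ε₂₉` asserted for anybody (∃-outputs); nothing of Bałaban's asserted; V23 NOT registered by this file; K0⁷ (stmt-QuantumFields-20541)
∕ K1⁹ (27364) ∕ K3⁸ (27366) NOT closed; N07 ∕ N24 NOT discharged; counts UNMOVED (typed 28∕28 · discharged 8∕28, route display 8∕27 excl. NODE O; K 1∕4 — the chair's words); R4 = the
CONDITIONAL finite-𝕋⁴ rung `BalabanLadder.UV` at fixed `ε = L^(−K)` only — NOT continuum ∕ ℝ⁴ ∕ OS; the Yang–Mills mass gap (Clay) is NOT proved by any of this.  Standard axioms only.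
-/

noncomputable section

open scoped Matrix.Norms.L2Operator

namespace Summit.QuantumFields.YangMills.Theorems.K0V23DoorPackage

open Literature.MathematicalPhysics.QuantumFieldTheory.Balaban1983to89
open Literature.MathematicalPhysics.QuantumFieldTheory.Balaban1983to89.Node00
open Literature.MathematicalPhysics.QuantumFieldTheory.Balaban1983to89.T4Continuum
open Literature.MathematicalPhysics.QuantumFieldTheory.Balaban1983to89.FlowStep
open Literature.MathematicalPhysics.QuantumFieldTheory.Balaban1983to89.B15DeterminingSets
open Summit.QuantumFields.YangMills.Theorems.K0V23Defs (AbsBetaBoxAtThm1WitnessCCMGenGridGZBAt AbsBetaBoxAtThm1WitnessCCMGenGridGZBEps0At K0N09Eps0LetterAt absBetaBoxGenGridGZBAt_of_eps0)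
open Summit.QuantumFields.YangMills.Theorems.K0V23Stub3NonVacuity (exists_radius_antecedentsZB_inhabited_below)

variable (F : T4Family)

/-! ## §1  A door below every ceiling (stub 1ᴮ PROVED + 2′ printed + 53′; no box needed) -/

/-- **A FURNISHED DOOR BELOW EVERY RADIUS CEILING**: for every `amax > 0` some door `(j, c, c₀, c₁; B₃, B₃′, a₀, a₁)` with `a₀ ≤ amax` carries the riders `c ≤ L^j`, `c₀ ≤ j+1`, `c₁ ≤ j`, the signs
`2L² ≤ B₃`, `0 < B₃′`, `0 < a₀`, `0 < a₁`, and BOTH [15] antecedents of the V23 3ᴬ′ᴮ text at print's datum: the ᴮ (8)-sentence and the ᴮ (9)-token under `A‴(c, c₀, c₁)` (g16's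
`exists_radius_antecedentsZB_inhabited_below` read at `a₀ := min ā amax`).  Unconditional (stub 1ᴮ ✓p767981, [6] Prop. 6 printed, 53′). [cite: Balaban1985Variational, Thm 1 (8)–(10) p.279, (7) p.278, Prop. 8 p.304; Balaban1985RegularSpaces, Prop. 6 p.99; Balaban1984PropagatorsII, (2.3) p.224; Balaban1988Convergent, (2.1) p.254, (2.5) p.255] -/
theorem exists_doorZB_below {amax : ℝ} (hamax : 0 < amax) :
    ∃ (j c c₀ c₁ : ℕ) (B₃ B₃' a₀ a₁ : ℝ), c ≤ F.L ^ j ∧ c₀ ≤ j + 1 ∧ c₁ ≤ j ∧ 2 * (F.L : ℝ) ^ 2 ≤ B₃ ∧ 0 < B₃' ∧ 0 < a₀ ∧ a₀ ≤ amax ∧ 0 < a₁ ∧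
      VariationalThm1RegSepCoP7MGB F 2
        (fun ν M g K k _s => c ≤ ν.M₁ ∧ k + c₀ ≤ F.m + K ∧ F.L ^ c₁ ∣ M ∧
          ∀ i, 1 ≤ i → i ≤ k → dCubeSide (F.P K).L M (RkOfRecord (F.P K).L ν.r (g i)) i ∣ (F.P K).sitesPerDir 0) (lamDatum F) (dataSmall7LamTopOf F 2) B₃ a₀ a₁ ∧
      Gauge9RegSepTopStepGB F 2 (fun ν K Ω => suppDomOfRecord F ν K Ω) (F.L ^ j)
        (fun ν M g K k _s => c ≤ ν.M₁ ∧ k + c₀ ≤ F.m + K ∧ F.L ^ c₁ ∣ M ∧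
          ∀ i, 1 ≤ i → i ≤ k → dCubeSide (F.P K).L M (RkOfRecord (F.P K).L ν.r (g i)) i ∣ (F.P K).sitesPerDir 0) (lamDatum F) (dataSmall7LamTopOf F 2) B₃ B₃' a₀ a₁ := by
  obtain ⟨ā, hā, hinh⟩ := exists_radius_antecedentsZB_inhabited_below F
  obtain ⟨j, c, c₀, c₁, B₃, B₃', a₁, hc, hc₀, hc₁, hB₃, hB₃', ha₁, h15, h9⟩ := hinh (min ā amax) (lt_min hā hamax) (min_le_left _ _)
  exact ⟨j, c, c₀, c₁, B₃, B₃', min ā amax, a₁, hc, hc₀, hc₁, hB₃, hB₃', lt_min hā hamax, min_le_right _ _, ha₁, h15, h9⟩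

/-! ## §2  ★ The full K0 door package from the V23 stub-3ᴬ′ᴮ text -/

/-- The K0–N09 interface letter at the top of its window: `2a₀ ≤ a₀L²` (`12 ≤ L`). [cite: Balaban1987RG1, (0.1) p.251, (1.2) p.260 (bookkeeping)] -/
private theorem eps0Letter_top {a₀ : ℝ} (ha₀ : 0 ≤ a₀) : K0N09Eps0LetterAt F a₀ a₀ := by
  have hL : (12 : ℝ) ≤ (F.L : ℝ) := by exact_mod_cast F.hL11
  have hL2 : (2 : ℝ) ≤ (F.L : ℝ) ^ 2 := by nlinarith
  show 2 * a₀ ≤ a₀ * (F.L : ℝ) ^ 2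
  nlinarith

/-- β of the Z3 member is blind to the normalisation letters (`rfl`; DEF-1's census restated without the residue import). [cite: Balaban1987RG1, (1.20)–(1.22) p.264 (bookkeeping)] -/
private theorem census (j : ℕ) (γ a₀ ε₀ ε₂₉ B₃ B₃' a₁ : ℝ) (Efl logz : B12.RunParams → ℕ → ℝ) :
    betaOfRecord₁₃ F 2 (theta13OfThm1CCMWZB F 2 j γ a₀ ε₀ ε₂₉ B₃ B₃' a₀ a₁ Efl logz) =
      betaOfRecord₁₃ F 2 (theta13OfThm1CCMWZB F 2 j γ a₀ ε₀ ε₂₉ B₃ B₃' a₀ a₁ (fun _ _ => 0) (fun _ _ => 0)) := rfl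


/-- Abs box on `]0, γ₀]` ⟹ a shrunk window `γ ≤ ½` with both letters and the box there (node00's `exists_window_letters_signFree` + `FlowStep.box_mono`; `0 ≤ β′` read off the non-empty box `]0, γ₀]^1`).
[cite: Balaban1987RG1, Thm 1 p.259, §1 p.264 (bookkeeping)] -/
private theorem window_of_absBox {β : HBeta} {γ₀ β' : ℝ} (hγ0 : 0 < γ₀) (hlow : BetaLowerH (-β') γ₀ β) (hup : BetaUpperH β' γ₀ β) :
    ∃ γ : ℝ, 0 < γ ∧ γ ≤ 1 / 2 ∧ -(-β') * γ ^ 2 ≤ 3 ∧ β' * γ ^ 2 ≤ 3 / 4 ∧ BetaLowerH (-β') γ β ∧ BetaUpperH β' γ β := by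
  have hv : (fun _ : Fin (0 + 1) => γ₀) ∈ Box γ₀ 0 := mem_box.mpr fun _ => ⟨hγ0, le_rfl⟩
  have hβ' : 0 ≤ β' := by
    have h1 := hlow 0 _ hv
    have h2 := hup 0 _ hv
    linarith
  obtain ⟨γ, hγpos, hγle, hγhalf, hl, hu⟩ := exists_window_letters_signFree hγ0 hβ'
  exact ⟨γ, hγpos, hγhalf, hl, hu, fun k v hv => hlow k v (box_mono hγle k hv), fun k v hv => hup k v (box_mono hγle k hv)⟩

/-- **★ THE K0 DOOR PACKAGE FROM THE V23 STUB-3ᴬ′ᴮ TEXT** (engine «N09T5»'s K0 prelude :203–232 in the V23 ∕ ᴮ currency, one call): if `K0V23Defs.AbsBetaBoxAtThm1WitnessCCMGenGridGZBAt F` then below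
every ceiling `amax > 0` there are a door `(j, c, c₀, c₁; B₃, B₃′, a₀, a₁)`, `a₀ ≤ amax`, with riders and signs, the ᴮ (8)-sentence `h15` and ᴮ (9)-token `h9` under `A‴(c, c₀, c₁)` at radius
`a₀`, the LOCATED-K0ε₀ letter AT `ε₀ = a₀`, a threshold `ε₂₉ > 0`, a bound `β′`, and a window `0 < γ ≤ ½` carrying the two letters `−(−β′)·γ² ≤ 3`, `β′·γ² ≤ ¾` and the sign-free box of the
β of record AT THE WINDOW-EDITION MEMBER `θ₁₃ᶜᶜᴹᵂᶻᴮ(j; γ; a₀; a₀, ε₂₉; B₃, B₃′, a₀, a₁; Efl, logz)` for EVERY `(Efl, logz)` (the half-window box of the text transferred by node00's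
`betaLowerH∕betaUpperH_theta13OfThm1CCMWZB_of_half`; letter-blindness `rfl`).  CONDITIONAL on the V23 text; nothing asserted. [cite: Balaban1987RG1, Thm 1 p.259, (1.2) p.260, §1 (1.20)–(1.22) p.264, (2.9) p.266, (0.21) p.256; Balaban1985Variational, Thm 1 (8)–(9) p.279, Prop. 8 p.304; Balaban1985RegularSpaces, Prop. 6 p.99; Balaban1984PropagatorsII, (2.3) p.224; Balaban1988Convergent, (2.1) p.254, (2.4)–(2.5) p.255; Balaban1989LargeFieldII, p.355] -/
theorem exists_doorPackageZB_of_absBetaBoxGZBAt (h3 : AbsBetaBoxAtThm1WitnessCCMGenGridGZBAt F) {amax : ℝ} (hamax : 0 < amax) :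
    ∃ (j c c₀ c₁ : ℕ) (B₃ B₃' a₀ a₁ γ ε₂₉ β' : ℝ), c ≤ F.L ^ j ∧ c₀ ≤ j + 1 ∧ c₁ ≤ j ∧ 2 * (F.L : ℝ) ^ 2 ≤ B₃ ∧ 0 < B₃' ∧ 0 < a₀ ∧ a₀ ≤ amax ∧ 0 < a₁ ∧
      VariationalThm1RegSepCoP7MGB F 2
        (fun ν M g K k _s => c ≤ ν.M₁ ∧ k + c₀ ≤ F.m + K ∧ F.L ^ c₁ ∣ M ∧
          ∀ i, 1 ≤ i → i ≤ k → dCubeSide (F.P K).L M (RkOfRecord (F.P K).L ν.r (g i)) i ∣ (F.P K).sitesPerDir 0) (lamDatum F) (dataSmall7LamTopOf F 2) B₃ a₀ a₁ ∧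
      Gauge9RegSepTopStepGB F 2 (fun ν K Ω => suppDomOfRecord F ν K Ω) (F.L ^ j)
        (fun ν M g K k _s => c ≤ ν.M₁ ∧ k + c₀ ≤ F.m + K ∧ F.L ^ c₁ ∣ M ∧
          ∀ i, 1 ≤ i → i ≤ k → dCubeSide (F.P K).L M (RkOfRecord (F.P K).L ν.r (g i)) i ∣ (F.P K).sitesPerDir 0) (lamDatum F) (dataSmall7LamTopOf F 2) B₃ B₃' a₀ a₁ ∧
      K0N09Eps0LetterAt F a₀ a₀ ∧ 0 < ε₂₉ ∧ 0 < γ ∧ γ ≤ 1 / 2 ∧ -(-β') * γ ^ 2 ≤ 3 ∧ β' * γ ^ 2 ≤ 3 / 4 ∧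
      ∀ Efl logz : B12.RunParams → ℕ → ℝ,
        BetaLowerH (-β') γ (betaOfRecord₁₃ F 2 (theta13OfThm1CCMWZB F 2 j γ a₀ a₀ ε₂₉ B₃ B₃' a₀ a₁ Efl logz)) ∧
        BetaUpperH β' γ (betaOfRecord₁₃ F 2 (theta13OfThm1CCMWZB F 2 j γ a₀ a₀ ε₂₉ B₃ B₃' a₀ a₁ Efl logz)) := by
  obtain ⟨j, c, c₀, c₁, B₃, B₃', a₀, a₁, hc, hc₀, hc₁, hB₃, hB₃', ha₀, ha₀le, ha₁, h15, h9⟩ := exists_doorZB_below F hamax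
  obtain ⟨γ₀, ε₀, ε₂₉, β', hγ₀, -, hε', hlow, hup⟩ := h3 j c c₀ c₁ B₃ B₃' a₀ a₁ hc hc₀ hc₁ hB₃ hB₃' ha₀ ha₁ h15 h9
  -- the text's box at label `ε₀` IS the box at label `a₀` (β is `ε₀`-blind, `rfl`)
  have hlow₀ : BetaLowerH (-β') γ₀ (betaOfRecord₁₃ F 2 (theta13OfThm1CCMWZB F 2 j (1 / 2) a₀ a₀ ε₂₉ B₃ B₃' a₀ a₁ (fun _ _ => 0) (fun _ _ => 0))) := hlow
  have hup₀ : BetaUpperH β' γ₀ (betaOfRecord₁₃ F 2 (theta13OfThm1CCMWZB F 2 j (1 / 2) a₀ a₀ ε₂₉ B₃ B₃' a₀ a₁ (fun _ _ => 0) (fun _ _ => 0))) := hup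
  obtain ⟨γ, hγpos, hγh, hl, hu, hlow', hup'⟩ := window_of_absBox hγ₀ hlow₀ hup₀
  refine ⟨j, c, c₀, c₁, B₃, B₃', a₀, a₁, γ, ε₂₉, β', hc, hc₀, hc₁, hB₃, hB₃', ha₀, ha₀le, ha₁, h15, h9, eps0Letter_top F ha₀.le, hε', hγpos, hγh, hl, hu,
    fun Efl logz => ?_⟩
  rw [census F j γ a₀ a₀ ε₂₉ B₃ B₃' a₁ Efl logz]
  exact ⟨betaLowerH_theta13OfThm1CCMWZB_of_half (Efl := fun _ _ => 0) (logz := fun _ _ => 0) hγh hlow',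
    betaUpperH_theta13OfThm1CCMWZB_of_half (Efl := fun _ _ => 0) (logz := fun _ _ => 0) hγh hup'⟩

/-- **★ THE PACKAGE WITH NODE 00's COMPARABILITY ROWS**: as `exists_doorPackageZB_of_absBetaBoxGZBAt`, plus — at every `(Efl, logz)` — NODE 00's two 2-COMPARABILITY rows `(hcomp) ∧ (hcompRev)` of the (2.4)-profile `cR·ε_k` along in-window runs of the window-edition member
(node00's `hcompBoth_theta13OfThm1CCMWZB_of_betaBoxSignFree` fed by the package's own box and letters; signs `0 ≤ B₃, 0 ≤ B₃′, 0 ≤ a₀, 0 ≤ a₁` from the package).  CONDITIONAL on the V23 text.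
[cite: Balaban1988Convergent, (2.4)–(2.8) pp.255–256, (2.28) p.259; Balaban1987RG1, Thm 1 p.259, §1 (1.20)–(1.22) p.264; Balaban1985Variational, Thm 1 (8)–(9) p.279; Balaban1989LargeFieldII, p.355] -/
theorem exists_doorPackageZB_comparable_of_absBetaBoxGZBAt (h3 : AbsBetaBoxAtThm1WitnessCCMGenGridGZBAt F) {amax : ℝ} (hamax : 0 < amax) :
    ∃ (j c c₀ c₁ : ℕ) (B₃ B₃' a₀ a₁ γ ε₂₉ β' : ℝ), c ≤ F.L ^ j ∧ c₀ ≤ j + 1 ∧ c₁ ≤ j ∧ 2 * (F.L : ℝ) ^ 2 ≤ B₃ ∧ 0 < B₃' ∧ 0 < a₀ ∧ a₀ ≤ amax ∧ 0 < a₁ ∧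
      VariationalThm1RegSepCoP7MGB F 2
        (fun ν M g K k _s => c ≤ ν.M₁ ∧ k + c₀ ≤ F.m + K ∧ F.L ^ c₁ ∣ M ∧
          ∀ i, 1 ≤ i → i ≤ k → dCubeSide (F.P K).L M (RkOfRecord (F.P K).L ν.r (g i)) i ∣ (F.P K).sitesPerDir 0) (lamDatum F) (dataSmall7LamTopOf F 2) B₃ a₀ a₁ ∧
      Gauge9RegSepTopStepGB F 2 (fun ν K Ω => suppDomOfRecord F ν K Ω) (F.L ^ j)
        (fun ν M g K k _s => c ≤ ν.M₁ ∧ k + c₀ ≤ F.m + K ∧ F.L ^ c₁ ∣ M ∧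
          ∀ i, 1 ≤ i → i ≤ k → dCubeSide (F.P K).L M (RkOfRecord (F.P K).L ν.r (g i)) i ∣ (F.P K).sitesPerDir 0) (lamDatum F) (dataSmall7LamTopOf F 2) B₃ B₃' a₀ a₁ ∧
      K0N09Eps0LetterAt F a₀ a₀ ∧ 0 < ε₂₉ ∧ 0 < γ ∧ γ ≤ 1 / 2 ∧ -(-β') * γ ^ 2 ≤ 3 ∧ β' * γ ^ 2 ≤ 3 / 4 ∧
      ∀ Efl logz : B12.RunParams → ℕ → ℝ,
        BetaLowerH (-β') γ (betaOfRecord₁₃ F 2 (theta13OfThm1CCMWZB F 2 j γ a₀ a₀ ε₂₉ B₃ B₃' a₀ a₁ Efl logz)) ∧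
        BetaUpperH β' γ (betaOfRecord₁₃ F 2 (theta13OfThm1CCMWZB F 2 j γ a₀ a₀ ε₂₉ B₃ B₃' a₀ a₁ Efl logz)) ∧
        (∀ (p : B12.RunParams) (n : ℕ), n ≤ p.K →
          Step.InInterval (theta13OfThm1CCMWZB F 2 j γ a₀ a₀ ε₂₉ B₃ B₃' a₀ a₁ Efl logz).γ n (gOfRecord₁₃ F 2 (theta13OfThm1CCMWZB F 2 j γ a₀ a₀ ε₂₉ B₃ B₃' a₀ a₁ Efl logz) p) → ∀ m, m < n →
            (theta13OfThm1CCMWZB F 2 j γ a₀ a₀ ε₂₉ B₃ B₃' a₀ a₁ Efl logz).s2.cR *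
                epsOfRecord (theta13OfThm1CCMWZB F 2 j γ a₀ a₀ ε₂₉ B₃ B₃' a₀ a₁ Efl logz).ν (gOfRecord₁₃ F 2 (theta13OfThm1CCMWZB F 2 j γ a₀ a₀ ε₂₉ B₃ B₃' a₀ a₁ Efl logz) p) m ≤
              2 * ((theta13OfThm1CCMWZB F 2 j γ a₀ a₀ ε₂₉ B₃ B₃' a₀ a₁ Efl logz).s2.cR *
                epsOfRecord (theta13OfThm1CCMWZB F 2 j γ a₀ a₀ ε₂₉ B₃ B₃' a₀ a₁ Efl logz).ν (gOfRecord₁₃ F 2 (theta13OfThm1CCMWZB F 2 j γ a₀ a₀ ε₂₉ B₃ B₃' a₀ a₁ Efl logz) p) (m + 1))) ∧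
        (∀ (p : B12.RunParams) (n : ℕ), n ≤ p.K →
          Step.InInterval (theta13OfThm1CCMWZB F 2 j γ a₀ a₀ ε₂₉ B₃ B₃' a₀ a₁ Efl logz).γ n (gOfRecord₁₃ F 2 (theta13OfThm1CCMWZB F 2 j γ a₀ a₀ ε₂₉ B₃ B₃' a₀ a₁ Efl logz) p) → ∀ m, m < n →
            (theta13OfThm1CCMWZB F 2 j γ a₀ a₀ ε₂₉ B₃ B₃' a₀ a₁ Efl logz).s2.cR *
                epsOfRecord (theta13OfThm1CCMWZB F 2 j γ a₀ a₀ ε₂₉ B₃ B₃' a₀ a₁ Efl logz).ν (gOfRecord₁₃ F 2 (theta13OfThm1CCMWZB F 2 j γ a₀ a₀ ε₂₉ B₃ B₃' a₀ a₁ Efl logz) p) (m + 1) ≤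
              2 * ((theta13OfThm1CCMWZB F 2 j γ a₀ a₀ ε₂₉ B₃ B₃' a₀ a₁ Efl logz).s2.cR *
                epsOfRecord (theta13OfThm1CCMWZB F 2 j γ a₀ a₀ ε₂₉ B₃ B₃' a₀ a₁ Efl logz).ν (gOfRecord₁₃ F 2 (theta13OfThm1CCMWZB F 2 j γ a₀ a₀ ε₂₉ B₃ B₃' a₀ a₁ Efl logz) p) m)) := by
  obtain ⟨j, c, c₀, c₁, B₃, B₃', a₀, a₁, γ, ε₂₉, β', hc, hc₀, hc₁, hB₃, hB₃', ha₀, ha₀le, ha₁, h15, h9, hlet, hε', hγpos, hγh, hl, hu, hbox⟩ :=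
    exists_doorPackageZB_of_absBetaBoxGZBAt F h3 hamax
  have hL : (0 : ℝ) < (F.L : ℝ) := by exact_mod_cast lt_trans Nat.zero_lt_one F.hL.2
  have hB : (0 : ℝ) ≤ B₃ := (mul_pos two_pos (pow_pos hL 2)).le.trans hB₃
  refine ⟨j, c, c₀, c₁, B₃, B₃', a₀, a₁, γ, ε₂₉, β', hc, hc₀, hc₁, hB₃, hB₃', ha₀, ha₀le, ha₁, h15, h9, hlet, hε', hγpos, hγh, hl, hu, fun Efl logz => ?_⟩
  obtain ⟨hlo, hhi⟩ := hbox Efl logz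
  obtain ⟨h1, h2⟩ := hcompBoth_theta13OfThm1CCMWZB_of_betaBoxSignFree (Efl := Efl) (logz := logz) hγh hB hB₃'.le ha₀.le ha₁.le hlo hhi hl hu
  exact ⟨hlo, hhi, h1, h2⟩

/-! ## §3  The `∀ F` forms (the skeleton's stub type and the strengthened text) -/

/-- **The `∀ F` form for the skeleton's stub** `∀ F, …GZBAt F` (the type of `stub_absBetaBoxAtThm1WitnessCCMGenGridGZB13` once V23 is registered): the door package at every family, below any
family-dependent ceiling.  CONDITIONAL. [cite: Balaban1987RG1, Thm 1 p.259, §1 (1.20)–(1.22) p.264; Balaban1985Variational, Thm 1 (8)–(9) p.279; Balaban1989LargeFieldII, p.355] -/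
theorem forall_exists_doorPackageZB_of_forall_absBetaBoxGZBAt (h3 : ∀ F : T4Family, AbsBetaBoxAtThm1WitnessCCMGenGridGZBAt F) (amax : T4Family → ℝ) (hamax : ∀ F, 0 < amax F) :
    ∀ F : T4Family, ∃ (j c c₀ c₁ : ℕ) (B₃ B₃' a₀ a₁ γ ε₂₉ β' : ℝ), c ≤ F.L ^ j ∧ c₀ ≤ j + 1 ∧ c₁ ≤ j ∧ 2 * (F.L : ℝ) ^ 2 ≤ B₃ ∧ 0 < B₃' ∧ 0 < a₀ ∧ a₀ ≤ amax F ∧ 0 < a₁ ∧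
      VariationalThm1RegSepCoP7MGB F 2
        (fun ν M g K k _s => c ≤ ν.M₁ ∧ k + c₀ ≤ F.m + K ∧ F.L ^ c₁ ∣ M ∧
          ∀ i, 1 ≤ i → i ≤ k → dCubeSide (F.P K).L M (RkOfRecord (F.P K).L ν.r (g i)) i ∣ (F.P K).sitesPerDir 0) (lamDatum F) (dataSmall7LamTopOf F 2) B₃ a₀ a₁ ∧
      Gauge9RegSepTopStepGB F 2 (fun ν K Ω => suppDomOfRecord F ν K Ω) (F.L ^ j)
        (fun ν M g K k _s => c ≤ ν.M₁ ∧ k + c₀ ≤ F.m + K ∧ F.L ^ c₁ ∣ M ∧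
          ∀ i, 1 ≤ i → i ≤ k → dCubeSide (F.P K).L M (RkOfRecord (F.P K).L ν.r (g i)) i ∣ (F.P K).sitesPerDir 0) (lamDatum F) (dataSmall7LamTopOf F 2) B₃ B₃' a₀ a₁ ∧
      K0N09Eps0LetterAt F a₀ a₀ ∧ 0 < ε₂₉ ∧ 0 < γ ∧ γ ≤ 1 / 2 ∧ -(-β') * γ ^ 2 ≤ 3 ∧ β' * γ ^ 2 ≤ 3 / 4 ∧
      ∀ Efl logz : B12.RunParams → ℕ → ℝ,
        BetaLowerH (-β') γ (betaOfRecord₁₃ F 2 (theta13OfThm1CCMWZB F 2 j γ a₀ a₀ ε₂₉ B₃ B₃' a₀ a₁ Efl logz)) ∧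
        BetaUpperH β' γ (betaOfRecord₁₃ F 2 (theta13OfThm1CCMWZB F 2 j γ a₀ a₀ ε₂₉ B₃ B₃' a₀ a₁ Efl logz)) :=
  fun F => exists_doorPackageZB_of_absBetaBoxGZBAt F (h3 F) (hamax F)

/-- The strengthened text of LOCATED-K0ε₀ (`…GZBEps0At F`) yields the same package (it implies the V23 text, ✓p767853 `absBetaBoxGenGridGZBAt_of_eps0`). CONDITIONAL.
[cite: Balaban1987RG1, Thm 1 p.259, (1.2) p.260, §1 (1.20)–(1.22) p.264; Balaban1985Variational, Thm 1 (8)–(9) p.279 (bookkeeping)] -/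
theorem exists_doorPackageZB_of_absBetaBoxGZBEps0At (h : AbsBetaBoxAtThm1WitnessCCMGenGridGZBEps0At F) {amax : ℝ} (hamax : 0 < amax) :
    ∃ (j c c₀ c₁ : ℕ) (B₃ B₃' a₀ a₁ γ ε₂₉ β' : ℝ), c ≤ F.L ^ j ∧ c₀ ≤ j + 1 ∧ c₁ ≤ j ∧ 2 * (F.L : ℝ) ^ 2 ≤ B₃ ∧ 0 < B₃' ∧ 0 < a₀ ∧ a₀ ≤ amax ∧ 0 < a₁ ∧
      VariationalThm1RegSepCoP7MGB F 2
        (fun ν M g K k _s => c ≤ ν.M₁ ∧ k + c₀ ≤ F.m + K ∧ F.L ^ c₁ ∣ M ∧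
          ∀ i, 1 ≤ i → i ≤ k → dCubeSide (F.P K).L M (RkOfRecord (F.P K).L ν.r (g i)) i ∣ (F.P K).sitesPerDir 0) (lamDatum F) (dataSmall7LamTopOf F 2) B₃ a₀ a₁ ∧
      Gauge9RegSepTopStepGB F 2 (fun ν K Ω => suppDomOfRecord F ν K Ω) (F.L ^ j)
        (fun ν M g K k _s => c ≤ ν.M₁ ∧ k + c₀ ≤ F.m + K ∧ F.L ^ c₁ ∣ M ∧
          ∀ i, 1 ≤ i → i ≤ k → dCubeSide (F.P K).L M (RkOfRecord (F.P K).L ν.r (g i)) i ∣ (F.P K).sitesPerDir 0) (lamDatum F) (dataSmall7LamTopOf F 2) B₃ B₃' a₀ a₁ ∧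
      K0N09Eps0LetterAt F a₀ a₀ ∧ 0 < ε₂₉ ∧ 0 < γ ∧ γ ≤ 1 / 2 ∧ -(-β') * γ ^ 2 ≤ 3 ∧ β' * γ ^ 2 ≤ 3 / 4 ∧
      ∀ Efl logz : B12.RunParams → ℕ → ℝ,
        BetaLowerH (-β') γ (betaOfRecord₁₃ F 2 (theta13OfThm1CCMWZB F 2 j γ a₀ a₀ ε₂₉ B₃ B₃' a₀ a₁ Efl logz)) ∧
        BetaUpperH β' γ (betaOfRecord₁₃ F 2 (theta13OfThm1CCMWZB F 2 j γ a₀ a₀ ε₂₉ B₃ B₃' a₀ a₁ Efl logz)) :=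
  exists_doorPackageZB_of_absBetaBoxGZBAt F (absBetaBoxGenGridGZBAt_of_eps0 F h) hamax

end Summit.QuantumFields.YangMills.Theorems.K0V23DoorPackage

end
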